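import Literature.Probability.Percolation.QuadCrossingNoiseProofs
import Literature.Probability.Percolation.QuadCrossingNoiseDiscrete
import Literature.Probability.Percolation.QuadCrossingPushforward
import Literature.Probability.Percolation.QuadCrossingSpaceProofs
import HarnessLib

/-!
# Theorem 1.7 of Schramm–Smirnov: reduction to a connected cut

Topic `Probability/Percolation`.  Support file (proofs, no named fact) for the named fact
`SchrammSmirnov2011_thm_1_7`: it suffices to prove the factorization `𝓕_D ⊆ ∨_U 𝓕_U (mod μ)` (the
join over the components `U` of `D ∖ α`) for CONNECTED cuts `α` (`SchrammSmirnov2011_thm_1_7_of_connected`).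
A finite union `α = ⋃ᵢ γᵢ(I)` of paths is cut one path at a time: after `k` paths, each component `U`
of `D ∖ (γ₀ ∪ ⋯ ∪ γ_{k-1})` is an open connected domain, the restriction `μ_U` of `μ` to the quads
of `U` is a subsequential scaling limit in `U` (`IsSubseqQuadLimit.map_restrict`, from
`restrict_z2QuadConfig`: restricting the lattice configuration of `D` to the quads of `U` gives the
lattice configuration of `U`), the connected case in `U` with the cut `γ_k(I)` gives
`𝓕_U ⊆ ∨ 𝓕_{components of U ∖ γ_k} (mod μ_U)`, which pulls back to `ℋ_D` along the restriction
map (`AEIncluded.comap`, `comap_restrict_crossingSubfield`), and the components of `U ∖ γ_k(I)` lie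
in components of `D ∖ (γ₀ ∪ ⋯ ∪ γ_k)`.

## References

* O. Schramm, S. Smirnov, *On the scaling limits of planar percolation*, Ann. Probab. 39 (2011)
  1768–1814, arXiv:1101.5820, Thm. 1.7 and §4. [SchrammSmirnov2011]
-/

noncomputable section

open MeasureTheory Set Filter Topology
open scoped unitInterval
open Literature.Probability.LatticeModels

namespace Literature.Probability.Percolation

namespace QuadCrossing

variable {D U : Set ℂ}

/-! ### Restricting the lattice configuration -/

/-- **Restricting the lattice configuration of `D` to the quads of `U` gives the lattice
configuration of `U`.** [cite: SchrammSmirnov2011, Thm. 1.4 (4)] -/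
theorem restrict_z2QuadConfig (hU : IsOpen U) (hUD : U ⊆ D) (δ : ℝ) (ω : BondConfig (Site 2)) :
    QuadConfig.restrict hU hUD (z2QuadConfig D δ ω) = z2QuadConfig U δ ω := by
  apply SetLike.coe_injective
  rw [QuadConfig.coe_restrict, coe_z2QuadConfig, coe_z2QuadConfig,
    (Quad.isOpenEmbedding_incl hU hUD).isOpenMap.preimage_closure_eq_closure_preimage
      (Quad.continuous_incl hUD)]
  rfl

/-- **The restriction of the lattice crossing law of `D` is the lattice crossing law of `U`.** [folklore] -/
theorem squareCrossingLaw_map_restrict (hD : IsOpen D) (hU : IsOpen U) (hUD : U ⊆ D) {δ : ℝ} (hδ : 0 < δ) :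
    (squareCrossingLaw D δ).map (QuadConfig.restrict hU hUD) = squareCrossingLaw U δ := by
  rw [squareCrossingLaw_eq_z2QuadLaw, squareCrossingLaw_eq_z2QuadLaw]
  apply FiniteMeasure.toMeasure_injective
  have h1 : ((z2QuadLaw D (δ * Real.sqrt 2)).map (QuadConfig.restrict hU hUD) : Measure (QuadConfig U)) =
      ((bondPercolation (zdGraph 2) half).map (z2QuadConfig D (δ * Real.sqrt 2))).map (QuadConfig.restrict hU hUD) := by
    rw [FiniteMeasure.toMeasure_map, toMeasure_z2QuadLaw]
  have h2 : ((z2QuadLaw U (δ * Real.sqrt 2) : FiniteMeasure (QuadConfig U)) : Measure (QuadConfig U)) =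
      (bondPercolation (zdGraph 2) half).map (z2QuadConfig U (δ * Real.sqrt 2)) := toMeasure_z2QuadLaw _ _
  rw [h1, h2, Measure.map_map (QuadConfig.measurable_restrict hU hUD) (measurable_z2QuadConfig hD (by positivity))]
  congr 1
  funext ω
  exact restrict_z2QuadConfig hU hUD _ ω

/-- **Subsequential scaling limits restrict to subsequential scaling limits.** [cite: SchrammSmirnov2011, Thm. 1.4 (4) and Cor. 1.6] -/
theorem IsSubseqQuadLimit.map_restrict (hD : IsOpen D) (hU : IsOpen U) (hUD : U ⊆ D)
    {μ : FiniteMeasure (QuadConfig D)} (hμ : IsSubseqQuadLimit D μ) :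
    IsSubseqQuadLimit U (μ.map (QuadConfig.restrict hU hUD)) := by
  obtain ⟨δs, hpos, hlim, hconv⟩ := hμ
  refine ⟨δs, hpos, hlim, ?_⟩
  have hc := (FiniteMeasure.continuous_map (QuadConfig.continuous_restrict hU hUD) (Ω := QuadConfig D)).continuousAt.tendsto.comp hconv
  refine hc.congr fun k => ?_
  simp only [Function.comp]
  exact squareCrossingLaw_map_restrict hD hU hUD (hpos k)

/-! ### Pulling inclusions mod null sets back along a measurable map -/

/-- **Inclusions mod null sets pull back along measurable maps.** [folklore] -/
theorem AEIncluded.comap {Ω Ω' : Type*} {m₁ m₂ : MeasurableSpace Ω'} {mΩ : MeasurableSpace Ω}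
    {mΩ' : MeasurableSpace Ω'} {μ : Measure Ω} {f : Ω → Ω'} (hf : Measurable f)
    (h : AEIncluded (μ.map f) m₁ m₂) : AEIncluded μ (m₁.comap f) (m₂.comap f) := by
  rintro _ ⟨s, hs, rfl⟩
  obtain ⟨t, ht, hst⟩ := h s hs
  have hq : Measure.QuasiMeasurePreserving f μ (μ.map f) := ⟨hf, Measure.AbsolutelyContinuous.rfl⟩
  exact ⟨f ⁻¹' t, ⟨t, ht, rfl⟩, hq.preimage_ae_eq hst⟩

/-! ### One more cut -/

/-- The crossing field of the tree's noise file is the crossing subfield of the push-forward file. [folklore] -/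
private theorem crossingField_eq_crossingSubfield' (V : Set ℂ) :
    crossingField (D := D) V = QuadConfig.crossingSubfield (D := D) V := rfl

/-- **One more cut**: if `𝓕_D ⊆ ∨_{U} 𝓕_U (mod μ)` over the components `U` of the open set
`D ∖ A`, and the connected case of Theorem 1.7 holds, then for a connected finite-length cut `β`
also `𝓕_D ⊆ ∨ 𝓕_{components of D ∖ (A ∪ β)} (mod μ)`. [cite: SchrammSmirnov2011, proof of Thm. 1.7] -/
theorem aeIncluded_iSup_step
    (H : ∀ (D : Set ℂ), IsOpen D → IsConnected D → ∀ μ : FiniteMeasure (QuadConfig D),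
      IsSubseqQuadLimit D μ → ∀ α : Set ℂ, IsFiniteLengthPathUnion α → IsConnected α →
        AEIncluded (μ : Measure (QuadConfig D)) (inferInstance : MeasurableSpace (QuadConfig D))
          (⨆ x ∈ D \ α, crossingField (connectedComponentIn (D \ α) x)))
    (hD : IsOpen D) {μ : FiniteMeasure (QuadConfig D)} (hμ : IsSubseqQuadLimit D μ) {A : Set ℂ}
    (hA : IsClosed A)
    (hind : AEIncluded (μ : Measure (QuadConfig D)) (inferInstance : MeasurableSpace (QuadConfig D))
      (⨆ x ∈ D \ A, crossingField (connectedComponentIn (D \ A) x)))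
    {β : Set ℂ} (hβ : IsFiniteLengthPathUnion β) (hβc : IsConnected β) :
    AEIncluded (μ : Measure (QuadConfig D)) (inferInstance : MeasurableSpace (QuadConfig D))
      (⨆ x ∈ D \ (A ∪ β), crossingField (connectedComponentIn (D \ (A ∪ β)) x)) := by
  refine hind.trans (AEIncluded.iSup fun y => AEIncluded.iSup fun hy => ?_)
  -- the component `U` of `y` in `D ∖ A`
  set U : Set ℂ := connectedComponentIn (D \ A) y with hU
  have hDA : IsOpen (D \ A) := hD.sdiff hA
  have hUo : IsOpen U := hDA.connectedComponentIn
  have hUD : U ⊆ D := (connectedComponentIn_subset _ _).trans fun _ h => h.1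
  have hUc : IsConnected U := isConnected_connectedComponentIn_iff.2 hy
  -- the connected case in `U`
  have hμU := IsSubseqQuadLimit.map_restrict hD hUo hUD hμ
  have key := H U hUo hUc _ hμU β hβ hβc
  rw [FiniteMeasure.toMeasure_map] at key
  -- `𝓕_U ⊆ borel` on `ℋ_U`, pulled back
  have key' : AEIncluded ((μ : Measure (QuadConfig D)).map (QuadConfig.restrict hUo hUD))
      (QuadConfig.crossingSubfield (D := U) U)
      (⨆ x ∈ U \ β, crossingField (D := U) (connectedComponentIn (U \ β) x)) :=
    (AEIncluded.of_le (QuadConfig.crossingSubfield_le_borel (D := U) U)).trans key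
  have pulled := AEIncluded.comap (QuadConfig.measurable_restrict hUo hUD) key'
  rw [QuadConfig.comap_restrict_crossingSubfield hUo hUD subset_rfl] at pulled
  rw [crossingField_eq_crossingSubfield']
  refine pulled.mono_right ?_
  -- the pulled-back join sits inside the join over the components of `D ∖ (A ∪ β)`
  simp only [MeasurableSpace.comap_iSup]
  refine iSup_le fun x => iSup_le fun hx => ?_
  rw [crossingField_eq_crossingSubfield', QuadConfig.comap_restrict_crossingSubfield hUo hUD
    ((connectedComponentIn_subset _ _).trans fun _ h => h.1)]
  have hx' : x ∈ D \ (A ∪ β) := by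
    refine ⟨hUD hx.1, ?_⟩
    rintro (h | h)
    · exact ((connectedComponentIn_subset _ _) hx.1).2 h
    · exact hx.2 h
  have hsub : connectedComponentIn (U \ β) x ⊆ connectedComponentIn (D \ (A ∪ β)) x := by
    refine connectedComponentIn_mono x ?_
    rintro z ⟨hzU, hzβ⟩
    refine ⟨hUD hzU, ?_⟩
    rintro (h | h)
    · exact ((connectedComponentIn_subset _ _) hzU).2 h
    · exact hzβ h
  calc QuadConfig.crossingSubfield (D := D) (connectedComponentIn (U \ β) x)
      ≤ crossingField (D := D) (connectedComponentIn (D \ (A ∪ β)) x) := crossingField_mono hsub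
    _ ≤ ⨆ x ∈ D \ (A ∪ β), crossingField (D := D) (connectedComponentIn (D \ (A ∪ β)) x) :=
        le_iSup₂ (f := fun x _ => crossingField (D := D) (connectedComponentIn (D \ (A ∪ β)) x)) x hx'

/-! ### The reduction -/

/-- A single path of a finite-length family is a connected finite-length cut. [folklore] -/
theorem isFiniteLengthPathUnion_range {n : ℕ} {γ : Fin n → C(I, ℂ)}
    (hbv : ∀ i, BoundedVariationOn (γ i) univ)
    (hfin : {z : ℂ | ∃ p q : Fin n × I, p ≠ q ∧ γ p.1 p.2 = z ∧ γ q.1 q.2 = z}.Finite) (i : Fin n) :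
    IsFiniteLengthPathUnion (range (γ i)) := by
  refine ⟨1, fun _ => γ i, by rw [iUnion_const], fun _ => hbv i, hfin.subset ?_⟩
  rintro z ⟨p, q, hpq, hp, hq⟩
  refine ⟨(i, p.2), (i, q.2), ?_, hp, hq⟩
  intro h
  apply hpq
  have h2 : p.2 = q.2 := (Prod.ext_iff.1 h).2
  exact Prod.ext (Subsingleton.elim _ _) h2

/-- **Theorem 1.7 follows from its connected case.** [cite: SchrammSmirnov2011, Thm. 1.7] -/
theorem SchrammSmirnov2011_thm_1_7_of_connected
    (H : ∀ (D : Set ℂ), IsOpen D → IsConnected D → ∀ μ : FiniteMeasure (QuadConfig D),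
      IsSubseqQuadLimit D μ → ∀ α : Set ℂ, IsFiniteLengthPathUnion α → IsConnected α →
        AEIncluded (μ : Measure (QuadConfig D)) (inferInstance : MeasurableSpace (QuadConfig D))
          (⨆ x ∈ D \ α, crossingField (connectedComponentIn (D \ α) x))) :
    SchrammSmirnov2011_thm_1_7 := by
  intro D hD hDc μ hμ α hα
  obtain ⟨n, γ, rfl, hbv, hfin⟩ := hα
  -- induction on the number of paths cut so far
  have main : ∀ k : ℕ, k ≤ n →
      AEIncluded (μ : Measure (QuadConfig D)) (inferInstance : MeasurableSpace (QuadConfig D))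
        (⨆ x ∈ D \ ⋃ i : {i : Fin n // (i : ℕ) < k}, range (γ i),
          crossingField (connectedComponentIn (D \ ⋃ i : {i : Fin n // (i : ℕ) < k}, range (γ i)) x)) := by
    intro k
    induction k with
    | zero =>
      intro _
      -- no cut: `𝓕_D = borel`
      have he : (⋃ i : {i : Fin n // (i : ℕ) < 0}, range (γ i)) = ∅ := by
        ext z; simp
      rw [he, sdiff_empty]
      obtain ⟨x₀, hx₀⟩ := hDc.nonempty
      refine AEIncluded.of_le ?_
      calc (inferInstance : MeasurableSpace (QuadConfig D)) = QuadConfig.crossingSubfield (D := D) univ :=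
            (QuadConfig.crossingSubfield_univ_eq_borel SchrammSmirnov2011_thm_1_4_holds hD ⟨x₀, hx₀⟩).symm
        _ ≤ crossingField (D := D) (connectedComponentIn D x₀) := by
            rw [hDc.isPreconnected.connectedComponentIn hx₀]
            exact MeasurableSpace.generateFrom_mono fun A ⟨Q, _, hA⟩ => ⟨Q, Q.carrier_subset, hA⟩
        _ ≤ ⨆ x ∈ D, crossingField (D := D) (connectedComponentIn D x) :=
            le_iSup₂ (f := fun x _ => crossingField (D := D) (connectedComponentIn D x)) x₀ hx₀
    | succ k ih =>
      intro hk
      have hk' : k < n := hk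
      have step := aeIncluded_iSup_step H hD hμ ?_ (ih (by omega))
        (isFiniteLengthPathUnion_range hbv hfin ⟨k, hk'⟩)
        (isConnected_range (γ ⟨k, hk'⟩).continuous)
      · have he : (⋃ i : {i : Fin n // (i : ℕ) < k + 1}, range (γ i)) =
            (⋃ i : {i : Fin n // (i : ℕ) < k}, range (γ i)) ∪ range (γ ⟨k, hk'⟩) := by
          ext z
          simp only [mem_iUnion, mem_union]
          constructor
          · rintro ⟨⟨i, hi⟩, hz⟩
            rcases Nat.lt_succ_iff_lt_or_eq.1 hi with h | h
            · exact Or.inl ⟨⟨i, h⟩, hz⟩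
            · right
              have : i = ⟨k, hk'⟩ := Fin.ext h
              subst this
              exact hz
          · rintro (⟨⟨i, hi⟩, hz⟩ | hz)
            · exact ⟨⟨i, by omega⟩, hz⟩
            · exact ⟨⟨⟨k, hk'⟩, by simp⟩, hz⟩
        rw [he]
        exact step
      · exact isClosed_iUnion_of_finite fun i => (isCompact_range (γ i.1).continuous).isClosed
  have hfinal := main n le_rfl
  have he : (⋃ i : {i : Fin n // (i : ℕ) < n}, range (γ i)) = ⋃ i, range (γ i) := by
    ext z
    simp only [mem_iUnion]
    exact ⟨fun ⟨i, h⟩ => ⟨i.1, h⟩, fun ⟨i, h⟩ => ⟨⟨i, i.2⟩, h⟩⟩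
  rw [he] at hfinal
  exact hfinal

end QuadCrossing

end Literature.Probability.Percolation

end
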